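import Summits.RiemannHypothesis.RiemannHypothesis.Theorems.WeilWindowFlowWindowLipschitzStubGroundStateEnergy
import Summits.RiemannHypothesis.RiemannHypothesis.Theorems.WeilWindowFlowWindowLipschitzStubLocalizedCutAux2
import Summits.RiemannHypothesis.RiemannHypothesis.Theorems.WeilWindowFlowWindowLipschitzStubBarrierEnergy
import Summits.RiemannHypothesis.RiemannHypothesis.Theorems.OddSectorOddOneSignedWindowsFormDomainDilation
import Summits.RiemannHypothesis.RiemannHypothesis.Theorems.WeilParityEvenWinsArchPhiLipschitz
import HarnessLib

/-!
# PF persistence — the archimedean dilation virial of an `L²` window function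

Support file for the crux `EvenSectorBarta.EvenOneSignedWindows` (pub-rhpf campaign, THEORY 1:
the Hadamard edge law; mechanism statements only, no claim about RH), companion of
`PfPersistenceDilationProfile` / `PfPersistenceEdgeLaw`.

The edge law in virial form (`PfPersistenceEdgeLaw.mul_deriv_weilGroundEnergy_eq_neg`) needs the
DILATION PROFILE of a ground state to be differentiable at `η = 0`. This file proves the archimedean
part of that differentiability for EVERY square-integrable function of finite archimedean energy —
no smoothness, no parity, no support hypothesis:

* `weilArchVirialDensity t = (t ρ(t))' = e^{t/2}((2 + t) sinh t − 2t cosh t)/(4 sinh² t)`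
  (`hasDerivAt_mul_weilArchDensity`), with `|(tρ)'(t)| ≤ (3/2) t ρ(t)` (`abs_weilArchVirialDensity_le`)
  and the global decay `t ρ(t) ≤ C e^{-t/4}` (`mul_weilArchDensity_le_exp_neg`);
* **`hasDerivAt_archEnergy_weilDilate`**: for `f ∈ L²` with `∫₀^∞ ρ D(f) < ∞`,
  `η ↦ ∫₀^∞ ρ(t) D_t(f_η) dt` (`f_η = weilDilate η f`, `D_t(f_η) = D_{(1+η)t}(f)`) has derivative
  `-∫₀^∞ (tρ)'(t) D_t(f) dt` at `η = 0` — substitute `s = (1+η)t` and differentiate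
  `(1+η)⁻¹ ρ(s/(1+η)) = s⁻¹ Φ(s/(1+η))`, `Φ(t) = tρ(t)`, under the integral sign (domination by
  `C e^{-s/6} · 4‖f‖²`, since `D_s(f) ≤ 4‖f‖²`, `stub_barrierEnergy_weilIncrement_le_four`).

In Fourier variables `-∫ (tρ)' D_t(f) dt = ⟨σ ∂_σ Re ψ(1/4 + iσ/2)⟩_{|f̂|²}`; this is the archimedean
term of Bombieri's dilation virial (`Literature.NumberTheory.LFunctions.weilDilationVirial_eq`, stated
there for test functions only).
-/

set_option linter.dupNamespace false

noncomputable section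

open MeasureTheory Set Filter Metric
open scoped Topology

namespace Summit.RiemannHypothesis.RiemannHypothesis.Theorems.PfPersistence

open Literature.NumberTheory.LFunctions
open Summit.RiemannHypothesis.RiemannHypothesis.Theorems.WeilWindowFlowWindowLipschitz
open Summit.RiemannHypothesis.RiemannHypothesis.Theorems.OddSector (weilArchDensity_le_exp_neg)
open Literature.Barriers.HubbardSuperconductivity (sinh_le_self_mul_cosh)

/-! ## The density `(tρ)'` of the archimedean virial -/

/-- The **archimedean virial density** `(t ρ(t))' = e^{t/2}((2 + t) sinh t − 2t cosh t)/(4 sinh² t)`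
of `ρ(t) = e^{t/2}/(2 sinh t)` (`hasDerivAt_mul_weilArchDensity`); `→ 1/4` at `0⁺`, `O(t e^{-t/2})`
at infinity. [folklore] -/
def weilArchVirialDensity (t : ℝ) : ℝ :=
  Real.exp (t / 2) * ((2 + t) * Real.sinh t - 2 * t * Real.cosh t) / (4 * Real.sinh t ^ 2)

/-- `Φ(t) = t ρ(t)` has derivative `weilArchVirialDensity t` at every `t > 0`. [folklore] -/
theorem hasDerivAt_mul_weilArchDensity {t : ℝ} (ht : 0 < t) :
    HasDerivAt (fun s : ℝ ↦ s * weilArchDensity s) (weilArchVirialDensity t) t := by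
  have hS : 0 < Real.sinh t := Real.sinh_pos_iff.2 ht
  have hS2 : (2 : ℝ) * Real.sinh t ≠ 0 := by positivity
  have hw : HasDerivAt (fun y : ℝ ↦ Real.exp (y / 2) / (2 * Real.sinh y))
      ((Real.exp (t / 2) * (1 / 2) * (2 * Real.sinh t) - Real.exp (t / 2) * (2 * Real.cosh t)) /
        (2 * Real.sinh t) ^ 2) t :=
    ((hasDerivAt_id' t).div_const 2).exp.fun_div ((Real.hasDerivAt_sinh t).const_mul 2) hS2
  have hG := (hasDerivAt_id' t).fun_mul hw
  unfold weilArchDensity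
  refine hG.congr_deriv ?_
  unfold weilArchVirialDensity
  field_simp
  ring

/-- `|(2 + t) sinh t − 2t cosh t| ≤ 3t sinh t` for `t ≥ 0` (`t ≤ sinh t ≤ t cosh t`,
`cosh t ≤ sinh t + 1`). [folklore] -/
theorem abs_archBracket_le {t : ℝ} (ht : 0 ≤ t) :
    |(2 + t) * Real.sinh t - 2 * t * Real.cosh t| ≤ 3 * t * Real.sinh t := by
  have h1 : Real.sinh t ≤ t * Real.cosh t := sinh_le_self_mul_cosh ht
  have h2 : t ≤ Real.sinh t := Real.self_le_sinh_iff.2 ht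
  have h3 : Real.cosh t ≤ Real.sinh t + 1 := by
    have e := Real.cosh_sub_sinh t
    have : Real.exp (-t) ≤ 1 := Real.exp_le_one_iff.2 (by linarith)
    linarith
  have hs : 0 ≤ Real.sinh t := Real.sinh_nonneg_iff.2 ht
  have h4 : t * Real.cosh t ≤ t * Real.sinh t + t := by nlinarith
  have h5 : 0 ≤ t * Real.sinh t := mul_nonneg ht hs
  have h6 : 0 ≤ t * Real.cosh t := mul_nonneg ht (Real.cosh_pos t).le
  rw [abs_le]
  constructor
  · nlinarith
  · nlinarith

/-- `|(tρ)'(t)| ≤ (3/2) · t ρ(t)` for `t > 0`. [folklore] -/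
theorem abs_weilArchVirialDensity_le {t : ℝ} (ht : 0 < t) :
    |weilArchVirialDensity t| ≤ 3 / 2 * (t * weilArchDensity t) := by
  have hS : 0 < Real.sinh t := Real.sinh_pos_iff.2 ht
  have hB := abs_archBracket_le ht.le
  unfold weilArchVirialDensity weilArchDensity
  rw [abs_div, abs_mul, abs_of_pos (Real.exp_pos _),
    abs_of_pos (by positivity : (0 : ℝ) < 4 * Real.sinh t ^ 2), div_le_iff₀ (by positivity)]
  calc Real.exp (t / 2) * |(2 + t) * Real.sinh t - 2 * t * Real.cosh t|
      ≤ Real.exp (t / 2) * (3 * t * Real.sinh t) :=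
        mul_le_mul_of_nonneg_left hB (Real.exp_pos _).le
    _ = 3 / 2 * (t * (Real.exp (t / 2) / (2 * Real.sinh t))) * (4 * Real.sinh t ^ 2) := by
        field_simp
        ring

/-- **Global decay of `Φ = tρ`**: `t ρ(t) ≤ (e^{3b/2}/2 + 4/(1 − e^{-4b})) e^{-t/4}` for all
`t > 0` (`b > 0` arbitrary): `ρ ≤ e^{t/2}/(2t)` on `t ≤ 2b`, `ρ ≤ e^{-t/2}/(1 − e^{-4b})` on
`t ≥ 2b` and `t e^{-t/4} ≤ 4`. [folklore] -/
theorem mul_weilArchDensity_le_exp_neg {b t : ℝ} (hb : 0 < b) (ht : 0 < t) :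
    t * weilArchDensity t ≤
      (Real.exp (3 * b / 2) / 2 + 4 / (1 - Real.exp (-(4 * b)))) * Real.exp (-(t / 4)) := by
  have hq : 0 < 1 - Real.exp (-(4 * b)) := by
    rw [sub_pos, Real.exp_lt_one_iff]
    linarith
  have hA : 0 ≤ Real.exp (3 * b / 2) / 2 * Real.exp (-(t / 4)) := by positivity
  have hB : 0 ≤ 4 / (1 - Real.exp (-(4 * b))) * Real.exp (-(t / 4)) := by positivity
  rw [add_mul]
  rcases le_or_gt t (2 * b) with htb | htb
  · have h1 : t * weilArchDensity t ≤ Real.exp (t / 2) / 2 :=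
      calc t * weilArchDensity t ≤ t * (Real.exp (t / 2) / (2 * t)) :=
            mul_le_mul_of_nonneg_left (weilArchDensity_le_exp_half_div ht) ht.le
        _ = Real.exp (t / 2) / 2 := by field_simp
    have h2 : Real.exp (t / 2) ≤ Real.exp (3 * b / 2) * Real.exp (-(t / 4)) := by
      rw [← Real.exp_add]
      exact Real.exp_le_exp.2 (by linarith)
    have h3 : t * weilArchDensity t ≤ Real.exp (3 * b / 2) / 2 * Real.exp (-(t / 4)) := by
      linarith
    exact h3.trans (le_add_of_nonneg_right hB)
  · have h1 := weilArchDensity_le_exp_neg hb htb.le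
    have h3 : t * Real.exp (-(t / 4)) ≤ 4 := by
      have h := Real.add_one_le_exp (t / 4)
      have hpos : 0 < Real.exp (-(t / 4)) := Real.exp_pos _
      have hmul : Real.exp (t / 4) * Real.exp (-(t / 4)) = 1 := by
        rw [← Real.exp_add]; simp
      calc t * Real.exp (-(t / 4)) ≤ (4 * Real.exp (t / 4)) * Real.exp (-(t / 4)) :=
            mul_le_mul_of_nonneg_right (by linarith) hpos.le
        _ = 4 := by rw [mul_assoc, hmul, mul_one]
    have he : Real.exp (-(t / 2)) = Real.exp (-(t / 4)) * Real.exp (-(t / 4)) := by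
      rw [← Real.exp_add]
      congr 1
      ring
    have h4 : t * weilArchDensity t ≤ 4 / (1 - Real.exp (-(4 * b))) * Real.exp (-(t / 4)) :=
      calc t * weilArchDensity t ≤ t * (Real.exp (-(t / 2)) / (1 - Real.exp (-(4 * b)))) :=
            mul_le_mul_of_nonneg_left h1 ht.le
        _ = (t * Real.exp (-(t / 4))) * Real.exp (-(t / 4)) / (1 - Real.exp (-(4 * b))) := by
            rw [he]; ring
        _ ≤ 4 * Real.exp (-(t / 4)) / (1 - Real.exp (-(4 * b))) :=
            div_le_div_of_nonneg_right (mul_le_mul_of_nonneg_right h3 (Real.exp_pos _).le) hq.le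
        _ = 4 / (1 - Real.exp (-(4 * b))) * Real.exp (-(t / 4)) := by ring
    exact h4.trans (le_add_of_nonneg_left hA)

/-- **Uniform exponential bound for the virial density**: `|(tρ)'(t)| ≤ C e^{-t/4}` on `(0, ∞)`
for an explicit `C > 0`. [folklore] -/
theorem exists_abs_weilArchVirialDensity_le :
    ∃ C : ℝ, 0 < C ∧ ∀ t : ℝ, 0 < t → |weilArchVirialDensity t| ≤ C * Real.exp (-(t / 4)) := by
  have hq : 0 < 1 - Real.exp (-(4 * (1 : ℝ))) := by
    rw [sub_pos, Real.exp_lt_one_iff]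
    norm_num
  refine ⟨3 / 2 * (Real.exp (3 * 1 / 2) / 2 + 4 / (1 - Real.exp (-(4 * 1)))), by positivity,
    fun t ht ↦ ?_⟩
  calc |weilArchVirialDensity t| ≤ 3 / 2 * (t * weilArchDensity t) := abs_weilArchVirialDensity_le ht
    _ ≤ 3 / 2 * ((Real.exp (3 * 1 / 2) / 2 + 4 / (1 - Real.exp (-(4 * 1)))) *
          Real.exp (-(t / 4))) :=
        mul_le_mul_of_nonneg_left (mul_weilArchDensity_le_exp_neg one_pos ht) (by norm_num)
    _ = _ := by ring

/-- `weilArchVirialDensity` is measurable. [folklore] -/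
theorem measurable_weilArchVirialDensity : Measurable weilArchVirialDensity := by
  unfold weilArchVirialDensity
  exact ((Real.continuous_exp.measurable.comp (measurable_id.div_const 2)).mul
    (((measurable_const.add measurable_id).mul Real.continuous_sinh.measurable).sub
      ((measurable_const.mul measurable_id).mul Real.continuous_cosh.measurable))).div
    (measurable_const.mul (Real.continuous_sinh.measurable.pow_const 2))

/-! ## Differentiating the archimedean energy along the dilation orbit -/

/-- **The archimedean energy is differentiable along the dilation orbit, for every `L²` function of
finite archimedean energy.** For `f ∈ L²` with `∫₀^∞ ρ(t) D_t(f) dt < ∞`, the function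
`η ↦ ∫₀^∞ ρ(t) D_t(weilDilate η f) dt` has derivative `-∫₀^∞ (tρ)'(s) D_s(f) ds` at `η = 0`
(substitution `s = (1+η)t`, then differentiation under the integral sign, dominated by
`C e^{-s/6} · 4‖f‖²`). [folklore] -/
theorem hasDerivAt_archEnergy_weilDilate {f : ℝ → ℂ} (hf : MemLp f 2)
    (hE : IntegrableOn (fun t ↦ weilArchDensity t * weilIncrement f t) (Ioi 0)) :
    HasDerivAt (fun η ↦ ∫ t in Ioi (0 : ℝ), weilArchDensity t * weilIncrement (weilDilate η f) t)
      (-∫ s in Ioi (0 : ℝ), weilArchVirialDensity s * weilIncrement f s) 0 := by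
  obtain ⟨C, hC, hCb⟩ := exists_abs_weilArchVirialDensity_le
  set N : ℝ := ∫ x, ‖f x‖ ^ 2 with hN
  have hN0 : 0 ≤ N := integral_nonneg fun x ↦ by positivity
  have hDm : AEStronglyMeasurable (weilIncrement f) volume :=
    stub_localizedCut_aesm_weilIncrement hf.1
  have hD0 : ∀ s, 0 ≤ weilIncrement f s := weilIncrement_nonneg f
  have hD4 : ∀ s, weilIncrement f s ≤ 4 * N := stub_barrierEnergy_weilIncrement_le_four hf
  -- the substituted integrand and its `η`-derivative
  set F : ℝ → ℝ → ℝ :=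
    fun η s ↦ (1 + η)⁻¹ * weilArchDensity (s * (1 + η)⁻¹) * weilIncrement f s with hF
  set F' : ℝ → ℝ → ℝ :=
    fun η s ↦ -(weilArchVirialDensity (s * (1 + η)⁻¹) * ((1 + η) ^ 2)⁻¹ * weilIncrement f s)
    with hF'
  -- Step 1: substitution `s = (1+η)t`
  have hEq : ∀ η : ℝ, -1 < η →
      ∫ t in Ioi (0 : ℝ), weilArchDensity t * weilIncrement (weilDilate η f) t =
        ∫ s in Ioi (0 : ℝ), F η s := by
    intro η hη
    have hc : 0 < 1 + η := by linarith
    have key : ∀ t : ℝ, (1 + η) * t * (1 + η)⁻¹ = t := fun t ↦ by field_simp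
    have h1 : (fun t ↦ weilArchDensity t * weilIncrement (weilDilate η f) t) =
        fun t ↦ (fun u ↦ weilArchDensity (u * (1 + η)⁻¹) * weilIncrement f u) ((1 + η) * t) := by
      funext t
      simp only [weilIncrement_weilDilate f hη, key]
    rw [h1, integral_comp_mul_left_Ioi
      (fun u ↦ weilArchDensity (u * (1 + η)⁻¹) * weilIncrement f u) 0 hc, mul_zero, smul_eq_mul,
      ← integral_const_mul]
    refine setIntegral_congr_fun measurableSet_Ioi (fun s _ ↦ ?_)
    simp only [hF]
    ring
  -- Step 2: differentiation under the integral sign on `(0, ∞)`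
  have hFm : ∀ η, AEStronglyMeasurable (F η) (volume.restrict (Ioi 0)) := fun η ↦ by
    have hm : Measurable fun s : ℝ ↦ (1 + η)⁻¹ * weilArchDensity (s * (1 + η)⁻¹) :=
      measurable_const.mul (measurable_weilArchDensity.comp (measurable_id.mul_const _))
    exact (hm.aestronglyMeasurable.mul hDm).restrict
  have hF0 : IntegrableOn (F 0) (Ioi 0) := by
    refine hE.congr_fun (fun s _ ↦ ?_) measurableSet_Ioi
    simp only [hF]
    simp
  have hF'm : AEStronglyMeasurable (F' 0) (volume.restrict (Ioi 0)) := by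
    have hm : Measurable fun s : ℝ ↦
        weilArchVirialDensity (s * (1 + (0 : ℝ))⁻¹) * ((1 + (0 : ℝ)) ^ 2)⁻¹ :=
      (measurable_weilArchVirialDensity.comp (measurable_id.mul_const _)).mul_const _
    exact ((hm.aestronglyMeasurable.mul hDm).restrict).neg
  have h_bound : ∀ᵐ s ∂(volume.restrict (Ioi (0 : ℝ))), ∀ η ∈ ball (0 : ℝ) (1 / 2),
      ‖F' η s‖ ≤ C * Real.exp (-(1 / 6) * s) * 4 * (4 * N) := by
    refine (ae_restrict_iff' measurableSet_Ioi).2 (Eventually.of_forall fun s hs η hη ↦ ?_)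
    have hs0 : (0 : ℝ) < s := hs
    have hη' : |η| < 1 / 2 := by simpa [Real.dist_eq] using hη
    have hη1 : 1 / 2 < 1 + η := by linarith [(abs_lt.1 hη').1]
    have hη2 : 1 + η < 3 / 2 := by linarith [(abs_lt.1 hη').2]
    have hc : 0 < 1 + η := by linarith
    have ht0 : 0 < s * (1 + η)⁻¹ := by positivity
    have hts : s ≤ 3 / 2 * (s * (1 + η)⁻¹) := by
      rw [← div_eq_mul_inv, mul_div_assoc', le_div_iff₀ hc]
      nlinarith
    have h1 : |weilArchVirialDensity (s * (1 + η)⁻¹)| ≤ C * Real.exp (-(1 / 6) * s) :=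
      (hCb _ ht0).trans
        (mul_le_mul_of_nonneg_left (Real.exp_le_exp.2 (by linarith)) hC.le)
    have hinv : ((1 + η) ^ 2)⁻¹ ≤ 4 := by
      rw [inv_le_comm₀ (by positivity) (by norm_num)]
      nlinarith
    simp only [hF', norm_neg, Real.norm_eq_abs, abs_mul, abs_of_pos (by positivity :
      (0 : ℝ) < ((1 + η) ^ 2)⁻¹), abs_of_nonneg (hD0 s)]
    exact mul_le_mul (mul_le_mul h1 hinv (by positivity) (by positivity)) (hD4 s) (hD0 s)
      (by positivity)
  have h_diff : ∀ᵐ s ∂(volume.restrict (Ioi (0 : ℝ))), ∀ η ∈ ball (0 : ℝ) (1 / 2),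
      HasDerivAt (fun η ↦ F η s) (F' η s) η := by
    refine (ae_restrict_iff' measurableSet_Ioi).2 (Eventually.of_forall fun s hs η hη ↦ ?_)
    have hs0 : (0 : ℝ) < s := hs
    have hη' : |η| < 1 / 2 := by simpa [Real.dist_eq] using hη
    have hc : 0 < 1 + η := by linarith [(abs_lt.1 hη').1]
    have ht0 : 0 < s * (1 + η)⁻¹ := by positivity
    have h1 : HasDerivAt (fun η : ℝ ↦ (1 + η)⁻¹) (-(1 : ℝ) / (1 + η) ^ 2) η :=
      ((hasDerivAt_id' η).const_add 1).inv hc.ne'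
    have h2 : HasDerivAt (fun η : ℝ ↦ s * (1 + η)⁻¹) (s * (-(1 : ℝ) / (1 + η) ^ 2)) η :=
      h1.const_mul s
    have h3 := (hasDerivAt_mul_weilArchDensity ht0).comp η h2
    have h4 := (h3.const_mul s⁻¹).mul_const (weilIncrement f s)
    -- near `η` the integrand equals `s⁻¹ Φ(s/(1+η')) D_s(f)`
    have hne : ∀ᶠ η' in 𝓝 η, 1 + η' ≠ 0 :=
      (continuous_const.add continuous_id).continuousAt.eventually_ne hc.ne'
    refine (h4.congr_of_eventuallyEq ?_).congr_deriv ?_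
    · filter_upwards [hne] with η' hη'
      simp only [hF, Function.comp_apply]
      field_simp
    · simp only [hF']
      field_simp
  have key := hasDerivAt_integral_of_dominated_loc_of_deriv_le (μ := volume.restrict (Ioi 0))
    (F := F) (F' := F') (x₀ := 0) (bound := fun s ↦ C * Real.exp (-(1 / 6) * s) * 4 * (4 * N))
    (ball_mem_nhds (0 : ℝ) (by norm_num : (0 : ℝ) < 1 / 2)) (Eventually.of_forall hFm) hF0 hF'm
    h_bound
    ((((exp_neg_integrableOn_Ioi 0 (by norm_num : (0 : ℝ) < 1 / 6)).const_mul C).mul_const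
      4).mul_const (4 * N)) h_diff
  -- Step 3: back to the original function and the stated derivative
  have hev : (fun η ↦ ∫ t in Ioi (0 : ℝ), weilArchDensity t * weilIncrement (weilDilate η f) t)
      =ᶠ[𝓝 0] fun η ↦ ∫ s in Ioi (0 : ℝ), F η s := by
    filter_upwards [Ioi_mem_nhds (show (-1 : ℝ) < 0 by norm_num)] with η hη
    exact hEq η hη
  refine (key.2.congr_of_eventuallyEq hev).congr_deriv ?_
  rw [← integral_neg]
  refine setIntegral_congr_fun measurableSet_Ioi (fun s _ ↦ ?_)
  simp only [hF']
  simp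

end Summit.RiemannHypothesis.RiemannHypothesis.Theorems.PfPersistence

end
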